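import Literature.Topology.FourManifolds.EuclideanRegularDomainBall
import Literature.Topology.FourManifolds.RegularSlabCobordism

/-!
# The ball-removed domain `{F ≤ 0} ∖ B̊(c, r/2)` as a cobordism between the round sphere
# `S(c, r/2)` and the hypersurface `{F = 0}`, inside `ℝ^{m+1}`

Topic `Literature/Topology/FourManifolds`; continuation of `EuclideanRegularDomainBall.lean`
(infrastructure for the fact seat
`provefact-Literature.Geometry.Riemannian.LawsonMichelsohn1984_surrounding`).  Everything here is
**proved**; no named fact is introduced.

For `h : IsRegularCompactDomain F` and a ball `B̄(c, r) ⊆ {F < 0}`, the ball-removed domain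
`W = (isRegularCompactDomain_ballRemovalFun h hr hball).Domain ⊆ ℝ^{m+1}` has boundary
`S(c, r/2) ⊔ {F = 0}` (`range_incl_comp_val_boundary_ballRemoval`).  Following the pattern of
`RegularSlabCobordism.lean` (the two levels of a slab) the two pieces are the open submanifolds
`innerEnd = {p ∈ ∂W | ‖p - c‖ < r}` and `outerEnd = {p ∈ ∂W | r < ‖p - c‖}` of the boundary
manifold `∂W`, and `W` is the cobordism `ballRemovalCobordism : Cobordism m innerEnd outerEnd`
(Milnor 1965, Def. 1.1; Kervaire–Milnor 1963, proof of Lemma 2.3: "removing the interior of an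
imbedded disk we obtain a manifold `W` with `bW = M + (-Sⁿ)`").  The inclusion `incl` carries
`innerEnd` onto the round sphere `S(c, r/2)` and `outerEnd` onto `{F = 0}`
(`range_incl_innerEnd`, `range_incl_outerEnd`).  This is Lawson–Michelsohn's starting point
for Thm. (6.1): `D = B̄ ∪ W`, with `B̄` a round ball (mean convex) and `W` to be read as handles
attached to `B̄` (Invent. Math. 77 (1984), §6), everything inside `ℝ^{m+1}`.

## References

* J. Milnor, *Lectures on the h-cobordism theorem*, Princeton (1965), Def. 1.1.
  [MilnorHCobordism1965]
* M. Kervaire, J. Milnor, *Groups of homotopy spheres I*, Ann. of Math. 77 (1963), proof of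
  Lemma 2.3 (p. 506). [KervaireMilnorAnnals1963]
-/

open scoped Manifold ContDiff Topology
open Set Function Metric

noncomputable section

namespace Literature.Topology.FourManifolds

namespace IsRegularCompactDomain

variable {m : ℕ} {F : EuclideanSpace ℝ (Fin (m + 1)) → ℝ} {c : EuclideanSpace ℝ (Fin (m + 1))}
  {r : ℝ}

/-- The ball-removed domain `W = {F ≤ 0} ∖ B̊(c, r/2)`, as the compact regular domain presented
by `ballRemovalFun F c r`. [folklore] -/
abbrev ballRemoval (h : IsRegularCompactDomain F) (hr : 0 < r)
    (hball : ∀ x, ‖x - c‖ ≤ r → F x < 0) : IsRegularCompactDomain (ballRemovalFun F c r) :=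
  isRegularCompactDomain_ballRemovalFun h hr hball

section Ends

variable (h : IsRegularCompactDomain F) (hr : 0 < r) (hball : ∀ x, ‖x - c‖ ≤ r → F x < 0)

/-- The distance to the centre, on the boundary of the ball-removed domain, is continuous.
[folklore] -/
theorem continuous_norm_incl_boundary :
    Continuous fun p : (𝓡∂ (m + 1)).boundary (h.ballRemoval hr hball).Domain =>
      ‖Domain.incl _ p.1 - c‖ :=
  ((Domain.continuous_incl _).comp continuous_subtype_val).sub continuous_const |>.norm

/-- A boundary point of the ball-removed domain lies on the small sphere or on `{F = 0}`.
[folklore] -/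
theorem norm_incl_eq_or_apply_eq (p : (𝓡∂ (m + 1)).boundary (h.ballRemoval hr hball).Domain) :
    ‖Domain.incl _ p.1 - c‖ = r / 2 ∨ F (Domain.incl _ p.1) = 0 := by
  have hp : Domain.incl _ p.1 ∈ range (fun q : (𝓡∂ (m + 1)).boundary
      (h.ballRemoval hr hball).Domain => Domain.incl _ q.1) := ⟨p, rfl⟩
  rw [range_incl_comp_val_boundary_ballRemoval h hr hball] at hp
  rcases hp with hs | hF
  · rw [mem_sphere, dist_eq_norm] at hs; exact Or.inl hs
  · exact Or.inr hF

/-- On `{F = 0}` the distance to the centre exceeds `r`. [folklore] -/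
theorem lt_norm_of_apply_eq_zero (hball : ∀ x, ‖x - c‖ ≤ r → F x < 0)
    {x : EuclideanSpace ℝ (Fin (m + 1))} (hx : F x = 0) : r < ‖x - c‖ := by
  by_contra h'
  exact (hball x (not_lt.1 h')).ne hx

/-- **The inner end**: the open piece of `∂W` within distance `r` of the centre (it is the
small sphere `S(c, r/2)`). [cite: MilnorHCobordism1965, Def. 1.1] -/
def innerEnd : TopologicalSpace.Opens ((𝓡∂ (m + 1)).boundary (h.ballRemoval hr hball).Domain) :=
  ⟨{p | ‖Domain.incl _ p.1 - c‖ < r},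
    isOpen_lt (continuous_norm_incl_boundary h hr hball) continuous_const⟩

/-- **The outer end**: the open piece of `∂W` at distance more than `r` from the centre (it is
the hypersurface `{F = 0}`). [cite: MilnorHCobordism1965, Def. 1.1] -/
def outerEnd : TopologicalSpace.Opens ((𝓡∂ (m + 1)).boundary (h.ballRemoval hr hball).Domain) :=
  ⟨{p | r < ‖Domain.incl _ p.1 - c‖},
    isOpen_lt continuous_const (continuous_norm_incl_boundary h hr hball)⟩

/-- A boundary point lies in the inner end iff it is on the small sphere. [folklore] -/
theorem mem_innerEnd_iff (p : (𝓡∂ (m + 1)).boundary (h.ballRemoval hr hball).Domain) :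
    p ∈ innerEnd h hr hball ↔ ‖Domain.incl _ p.1 - c‖ = r / 2 := by
  constructor
  · intro hp
    rcases norm_incl_eq_or_apply_eq h hr hball p with hs | hF
    · exact hs
    · exact absurd hp (not_lt.2 (lt_norm_of_apply_eq_zero hball hF).le)
  · intro hs
    show ‖Domain.incl _ p.1 - c‖ < r
    rw [hs]; linarith

/-- A boundary point lies in the outer end iff `F` vanishes there. [folklore] -/
theorem mem_outerEnd_iff (p : (𝓡∂ (m + 1)).boundary (h.ballRemoval hr hball).Domain) :
    p ∈ outerEnd h hr hball ↔ F (Domain.incl _ p.1) = 0 := by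
  constructor
  · intro hp
    rcases norm_incl_eq_or_apply_eq h hr hball p with hs | hF
    · have : r < ‖Domain.incl _ p.1 - c‖ := hp
      rw [hs] at this; linarith
    · exact hF
  · intro hF
    exact lt_norm_of_apply_eq_zero hball hF

/-- Points of the inner end lie on the small sphere. [folklore] -/
theorem norm_innerEnd (p : innerEnd h hr hball) : ‖Domain.incl _ p.1.1 - c‖ = r / 2 :=
  (mem_innerEnd_iff h hr hball p.1).1 p.2

/-- `F` vanishes on the outer end. [folklore] -/
theorem apply_outerEnd (p : outerEnd h hr hball) : F (Domain.incl _ p.1.1) = 0 :=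
  (mem_outerEnd_iff h hr hball p.1).1 p.2

/-- The two ends are disjoint. [folklore] -/
theorem disjoint_innerEnd_outerEnd :
    Disjoint (innerEnd h hr hball : Set ((𝓡∂ (m + 1)).boundary (h.ballRemoval hr hball).Domain))
      (outerEnd h hr hball : Set ((𝓡∂ (m + 1)).boundary (h.ballRemoval hr hball).Domain)) :=
  disjoint_left.2 fun _ (h1 : ‖_‖ < r) (h2 : r < ‖_‖) => lt_asymm h1 h2

/-- The two ends cover the boundary. [folklore] -/
theorem innerEnd_union_outerEnd :
    (innerEnd h hr hball : Set ((𝓡∂ (m + 1)).boundary (h.ballRemoval hr hball).Domain)) ∪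
      (outerEnd h hr hball :
        Set ((𝓡∂ (m + 1)).boundary (h.ballRemoval hr hball).Domain)) = univ := by
  refine eq_univ_of_forall fun p => ?_
  rcases norm_incl_eq_or_apply_eq h hr hball p with hs | hF
  · exact Or.inl ((mem_innerEnd_iff h hr hball p).2 hs)
  · exact Or.inr ((mem_outerEnd_iff h hr hball p).2 hF)

/-- The inner end is closed in `∂W`. [folklore] -/
theorem isClosed_innerEnd :
    IsClosed (innerEnd h hr hball :
      Set ((𝓡∂ (m + 1)).boundary (h.ballRemoval hr hball).Domain)) := by
  have : (innerEnd h hr hball : Set ((𝓡∂ (m + 1)).boundary (h.ballRemoval hr hball).Domain)) =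
      {p | ‖Domain.incl _ p.1 - c‖ ≤ r / 2} := by
    ext p
    rw [SetLike.mem_coe, mem_innerEnd_iff]
    refine ⟨fun h' => h'.le, fun h' => ?_⟩
    have h'' : ‖Domain.incl _ p.1 - c‖ ≤ r / 2 := h'
    rcases norm_incl_eq_or_apply_eq h hr hball p with hs | hF
    · exact hs
    · have := lt_norm_of_apply_eq_zero hball hF; linarith
  rw [this]
  exact isClosed_le (continuous_norm_incl_boundary h hr hball) continuous_const

/-- The outer end is closed in `∂W`. [folklore] -/
theorem isClosed_outerEnd :
    IsClosed (outerEnd h hr hball :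
      Set ((𝓡∂ (m + 1)).boundary (h.ballRemoval hr hball).Domain)) := by
  have : (outerEnd h hr hball : Set ((𝓡∂ (m + 1)).boundary (h.ballRemoval hr hball).Domain)) =
      {p | r ≤ ‖Domain.incl _ p.1 - c‖} := by
    ext p
    rw [SetLike.mem_coe, mem_outerEnd_iff]
    refine ⟨fun h' => (lt_norm_of_apply_eq_zero hball h').le, fun h' => ?_⟩
    have h'' : r ≤ ‖Domain.incl _ p.1 - c‖ := h'
    rcases norm_incl_eq_or_apply_eq h hr hball p with hs | hF
    · rw [hs] at h''; linarith
    · exact hF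
  rw [this]
  exact isClosed_le continuous_const (continuous_norm_incl_boundary h hr hball)

/-- The inner end is compact. [folklore] -/
instance instCompactSpaceInnerEnd : CompactSpace (innerEnd h hr hball) :=
  isCompact_iff_compactSpace.1 (isClosed_innerEnd h hr hball).isCompact

/-- The outer end is compact. [folklore] -/
instance instCompactSpaceOuterEnd : CompactSpace (outerEnd h hr hball) :=
  isCompact_iff_compactSpace.1 (isClosed_outerEnd h hr hball).isCompact

/-- The inner end is nonempty (it is a sphere of positive radius). [folklore] -/
instance instNonemptyInnerEnd : Nonempty (innerEnd h hr hball) := by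
  -- the point `c + (r/2) e` for a unit vector `e`
  obtain ⟨v, hv⟩ : ∃ v : EuclideanSpace ℝ (Fin (m + 1)), ‖v‖ = 1 :=
    ⟨EuclideanSpace.single 0 1, by simp⟩
  set x := c + (r / 2) • v with hx
  have hxn : ‖x - c‖ = r / 2 := by
    rw [hx, add_sub_cancel_left, norm_smul, hv, mul_one, Real.norm_eq_abs, abs_of_pos (by linarith)]
  have hxs : x ∈ sphere c (r / 2) ∪ {x | F x = 0} := Or.inl (by rw [mem_sphere, dist_eq_norm, hxn])
  rw [← range_incl_comp_val_boundary_ballRemoval h hr hball] at hxs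
  obtain ⟨p, hp⟩ := hxs
  exact ⟨⟨p, (mem_innerEnd_iff h hr hball p).2 (by simp only at hp; rw [hp, hxn])⟩⟩

/-- The outer end is nonempty as soon as `F` has a zero. [folklore] -/
theorem nonempty_outerEnd (hZ : {x | F x = 0}.Nonempty) : Nonempty (outerEnd h hr hball) := by
  obtain ⟨x, hx⟩ := hZ
  have hxs : x ∈ sphere c (r / 2) ∪ {x | F x = 0} := Or.inr hx
  rw [← range_incl_comp_val_boundary_ballRemoval h hr hball] at hxs
  obtain ⟨p, hp⟩ := hxs
  exact ⟨⟨p, (mem_outerEnd_iff h hr hball p).2 (by simp only at hp; rw [hp]; exact hx)⟩⟩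

end Ends

/-! ### The cobordism -/

section Cob

variable (h : IsRegularCompactDomain F) (hr : 0 < r) (hball : ∀ x, ‖x - c‖ ≤ r → F x < 0)

/-- **The ball-removed domain is a cobordism from the small sphere to the hypersurface**
`(W; S(c, r/2), {F = 0})`, `W = {F ≤ 0} ∖ B̊(c, r/2) ⊆ ℝ^{m+1}` (Milnor 1965, Def. 1.1;
Kervaire–Milnor 1963, proof of Lemma 2.3), with ends the open-and-closed pieces of `∂W`.
[cite: MilnorHCobordism1965, Def. 1.1 with Lemma 2.9] -/
def ballRemovalCobordism : Cobordism m (innerEnd h hr hball) (outerEnd h hr hball) where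
  W := (h.ballRemoval hr hball).Domain
  inl p := (p.1 : (h.ballRemoval hr hball).Domain)
  inr p := (p.1 : (h.ballRemoval hr hball).Domain)
  isSmoothEmbedding_inl := BoundaryManifold.isSmoothEmbedding_opens_val (innerEnd h hr hball)
  isSmoothEmbedding_inr := BoundaryManifold.isSmoothEmbedding_opens_val (outerEnd h hr hball)
  disjoint_range := by
    refine disjoint_left.2 ?_
    rintro z ⟨p, rfl⟩ ⟨q, hq⟩
    have h1 := norm_innerEnd h hr hball p
    have h2 := lt_norm_of_apply_eq_zero hball (apply_outerEnd h hr hball q)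
    have hpq : (q.1 : (h.ballRemoval hr hball).Domain) = p.1 := hq
    rw [hpq] at h2
    rw [h1] at h2
    linarith
  range_inl_union_range_inr := by
    ext z
    simp only [mem_union, mem_range]
    constructor
    · rintro (⟨p, rfl⟩ | ⟨p, rfl⟩)
      · exact p.1.2
      · exact p.1.2
    · intro hz
      rcases norm_incl_eq_or_apply_eq h hr hball ⟨z, hz⟩ with hs | hF
      · exact Or.inl ⟨⟨⟨z, hz⟩, (mem_innerEnd_iff h hr hball ⟨z, hz⟩).2 hs⟩, rfl⟩
      · exact Or.inr ⟨⟨⟨z, hz⟩, (mem_outerEnd_iff h hr hball ⟨z, hz⟩).2 hF⟩, rfl⟩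

/-- The total space of the ball-removal cobordism is the ball-removed domain (definitional).
[folklore] -/
@[simp] theorem ballRemovalCobordism_W :
    (ballRemovalCobordism h hr hball).W = (h.ballRemoval hr hball).Domain := rfl

/-- The incoming end of the ball-removal cobordism is the inclusion of the inner piece
(definitional). [folklore] -/
@[simp] theorem ballRemovalCobordism_inl (p : innerEnd h hr hball) :
    (ballRemovalCobordism h hr hball).inl p = (p.1 : (h.ballRemoval hr hball).Domain) := rfl

/-- The outgoing end of the ball-removal cobordism is the inclusion of the outer piece
(definitional). [folklore] -/
@[simp] theorem ballRemovalCobordism_inr (p : outerEnd h hr hball) :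
    (ballRemovalCobordism h hr hball).inr p = (p.1 : (h.ballRemoval hr hball).Domain) := rfl

/-- **The incoming end is carried onto the round sphere `S(c, r/2)`** by the inclusion
`W → ℝ^{m+1}`. [folklore] -/
theorem range_incl_inl :
    range (fun p : innerEnd h hr hball =>
      Domain.incl (h.ballRemoval hr hball) ((ballRemovalCobordism h hr hball).inl p))
      = sphere c (r / 2) := by
  ext x
  simp only [mem_range, mem_sphere, dist_eq_norm, ballRemovalCobordism_inl]
  constructor
  · rintro ⟨p, rfl⟩
    exact norm_innerEnd h hr hball p
  · intro hx
    have hxs : x ∈ sphere c (r / 2) ∪ {x | F x = 0} := Or.inl (by rw [mem_sphere, dist_eq_norm, hx])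
    rw [← range_incl_comp_val_boundary_ballRemoval h hr hball] at hxs
    obtain ⟨p, hp⟩ := hxs
    simp only at hp
    exact ⟨⟨p, (mem_innerEnd_iff h hr hball p).2 (by rw [hp, hx])⟩, hp⟩

/-- **The outgoing end is carried onto the hypersurface `{F = 0}`** by the inclusion
`W → ℝ^{m+1}`. [folklore] -/
theorem range_incl_inr :
    range (fun p : outerEnd h hr hball =>
      Domain.incl (h.ballRemoval hr hball) ((ballRemovalCobordism h hr hball).inr p))
      = {x | F x = 0} := by
  ext x
  simp only [mem_range, mem_setOf_eq, ballRemovalCobordism_inr]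
  constructor
  · rintro ⟨p, rfl⟩
    exact apply_outerEnd h hr hball p
  · intro hx
    have hxs : x ∈ sphere c (r / 2) ∪ {x | F x = 0} := Or.inr hx
    rw [← range_incl_comp_val_boundary_ballRemoval h hr hball] at hxs
    obtain ⟨p, hp⟩ := hxs
    simp only at hp
    exact ⟨⟨p, (mem_outerEnd_iff h hr hball p).2 (by rw [hp]; exact hx)⟩, hp⟩

/-- The points of the total space are the points of `{F ≤ 0}` outside `B(c, r/2)`. [folklore] -/
theorem range_incl_W :
    range (Domain.incl (h.ballRemoval hr hball)) = {x | F x ≤ 0} \ ball c (r / 2) :=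
  range_incl_ballRemoval h hr hball

end Cob

end IsRegularCompactDomain

end Literature.Topology.FourManifolds

end
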